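import Mathlib
import Summits.Langlands.Langlands.Theorems.CapacityClassicalityHilbertIntegralOverconvergentIsCongruenceAuxLinearForms
import Summits.Langlands.Langlands.Theorems.CapacityClassicalityHilbertIntegralOverconvergentIsCongruenceAlgMainArch
import Summits.Langlands.Langlands.Theorems.CapacityClassicalityHilbertIntegralOverconvergentIsCongruenceAlgMainGain
import Summits.Langlands.Langlands.Theorems.CapacityClassicalityHilbertIntegralOverconvergentIsCongruenceAlgMainConclude

/-!
# Crux `HilbertIntegralOverconvergentIsCongruence` (stmt-Langlands-8485), line `Sketch-ideate-r1-k1`: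
# the ALGEBRAIZATION ENGINE, `d = 1` instance (registered stub R8 `stub_algebraicMain`)

The Schneider–Lang assembly of RESHAPE 4 of the skeleton
`Cruxes/HilbertIntegralOverconvergentIsCongruence/Lines/Sketch_ideate_r1_k1.lean`: the five elementary
stubs of the reshape as hypotheses — R1 (weighted `ℓ¹` sizes submultiplicative), R3 (the integral
unitriangular basis `E₄^α E₆^β Δ^i` of `M_b(SL₂(ℤ))`), R4 (the `d`-free algebra of Katz data), R5 (the
arithmetic of the gain), R6 (the Siegel count) — imply `IntegralOverconvergentIsAlgebraicQ` in the
exact vocabulary of the sibling crux α = `IntegralOverconvergentIsCongruence`: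

*for `p ≥ 5` prime, `p ∤ N`, `k ∈ ℤ`, `ι : ℚ̄_p ≃ ℂ`, a number field `E` with `σ₀ : E → ℂ`, `a : ℕ → 𝓞_E`:
if `Σ σ(a_n) qⁿ` has radius `≥ 1` under every `σ : E → ℂ` and `g = Σ σ₀(a_n) qⁿ` is a `p`-adic Katz
surrogate of weight `k`, rate `r > 0` and tame level `Γ₁(N)` along `ι`, then `g` is ALGEBRAIC over the
ring of level-one modular forms: `Σ_{j ≤ D} F_j(q) g(q)^j = 0`, `F_j ∈ M_{b_j}(SL₂(ℤ))` classical,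
`b_j + jk = b_0`, not all zero.*

Siegel's lemma over `𝓞_E` + the `p`-adic Liouville inequality (`stub_auxLinearForms`, stub 16) with
exponents `X = ℕ`, unknowns `β D = Σ_{j < D} J(b_j)`, coefficients `c_D(u, ν) = coeff_ν(f_u g^{j_u}) ∈ 𝓞_E`;
the archimedean input is `stub_archBound` (Part I), the gain `stub_gainBound` (Part II: the graded
Katz–Sturm lever on the Sturm family `V b = ι⁻¹ M_b(Γ₁(N))`, Sturm's theorem PROVED in the tree), and
the passage from the Siegel solution to the classical relation is `stub_conclude` (Part III).
Parameters: `R = p^{12r/((p-1)μ)} > 1` (`μ = [SL₂(ℤ):Γ₁(N)]`), `η = log R/(4[E:ℚ])`, `t₀ = e^{-η}`.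

Theorems only, no `sorry`.
-/

set_option linter.dupNamespace false

noncomputable section

open scoped MatrixGroups NumberField

namespace Summit.Langlands.Langlands.Theorems.HilbertIntegralOverconvergentIsCongruence

/-- **Registered stub R8 (`stub_algebraicMain`) of line `Sketch-ideate-r1-k1`: the `d = 1`
algebraization engine** — stubs R1, R3, R4, R5, R6 (unfolded, as hypotheses) imply
`IntegralOverconvergentIsAlgebraicQ` (unfolded). [folklore] -/
theorem stub_algebraicMain :
    (∀ (φ ψ : PowerSeries ℂ) (t : ℝ) (_ : 0 ≤ t)
      (_ : Summable fun n : ℕ ↦ ‖PowerSeries.coeff n φ‖ * t ^ n)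
      (_ : Summable fun n : ℕ ↦ ‖PowerSeries.coeff n ψ‖ * t ^ n),
      Summable (fun n : ℕ ↦ ‖PowerSeries.coeff n (φ * ψ)‖ * t ^ n) ∧
        ∑' n : ℕ, ‖PowerSeries.coeff n (φ * ψ)‖ * t ^ n ≤
          (∑' n : ℕ, ‖PowerSeries.coeff n φ‖ * t ^ n) * ∑' n : ℕ, ‖PowerSeries.coeff n ψ‖ * t ^ n) →
    (∀ (b i : ℕ) (_ : Even b) (_ : 12 * i ≤ b) (_ : b - 12 * i ≠ 2),
      ∃ (α β : ℕ) (F : ModularForm 𝒮ℒ (b : ℤ)) (P : PowerSeries ℤ),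
        4 * α + 6 * β + 12 * i = b ∧
        UpperHalfPlane.qExpansion 1 ⇑F =
          UpperHalfPlane.qExpansion 1 ⇑ModularForm.E₄ ^ α * UpperHalfPlane.qExpansion 1 ⇑ModularForm.E₆ ^ β *
            UpperHalfPlane.qExpansion 1 ⇑CuspForm.discriminant ^ i ∧
        UpperHalfPlane.qExpansion 1 ⇑F = P.map (Int.castRingHom ℂ) ∧
        (∀ n < i, PowerSeries.coeff n P = 0) ∧ PowerSeries.coeff i P = 1) →
    (∀ {K σ U : Type} [NormedField K] [IsUltrametricDist K] [Fintype U]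
      (V : ℤ → Set (MvPowerSeries σ K)) (_ : (1 : MvPowerSeries σ K) ∈ V 0)
      (_ : ∀ b : ℤ, (0 : MvPowerSeries σ K) ∈ V b)
      (_ : ∀ (b : ℤ) (φ ψ : MvPowerSeries σ K), φ ∈ V b → ψ ∈ V b → φ + ψ ∈ V b)
      (_ : ∀ (b : ℤ) (c : K) (φ : MvPowerSeries σ K), φ ∈ V b → c • φ ∈ V b)
      (_ : ∀ (b₁ b₂ : ℤ) (φ ψ : MvPowerSeries σ K), φ ∈ V b₁ → ψ ∈ V b₂ → φ * ψ ∈ V (b₁ + b₂))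
      (e : MvPowerSeries σ K) (t : ℤ) (_ : MvPowerSeries.constantCoeff e = 1)
      (_ : ∀ n, ‖MvPowerSeries.coeff n e‖ ≤ 1)
      (a : ℕ → MvPowerSeries σ K) (w : ℤ) (_ : ∀ i : ℕ, a i ∈ V (w + i * t))
      (ρ C : ℝ) (_ : 0 ≤ ρ) (_ : ρ ≤ 1) (_ : 1 ≤ C) (_ : ∀ i n, ‖MvPowerSeries.coeff n (a i)‖ ≤ C * ρ ^ i)
      (G : MvPowerSeries σ K)
      (_ : ∀ n, HasSum (fun i : ℕ ↦ MvPowerSeries.coeff n (a i * e⁻¹ ^ i)) (MvPowerSeries.coeff n G))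
      (D : ℕ) (j : U → ℕ) (_ : ∀ u, j u ≤ D) (T : ℤ)
      (f : U → MvPowerSeries σ K) (_ : ∀ u, f u ∈ V (T - j u * w))
      (_ : ∀ u n, ‖MvPowerSeries.coeff n (f u)‖ ≤ 1) (l : U → K) (_ : ∀ u, ‖l u‖ ≤ 1),
      ∃ A : ℕ → MvPowerSeries σ K,
        (∀ i : ℕ, A i ∈ V (T + i * t)) ∧ (∀ i n, ‖MvPowerSeries.coeff n (A i)‖ ≤ C ^ D * ρ ^ i) ∧
        (∀ n, HasSum (fun i : ℕ ↦ MvPowerSeries.coeff n (A i * e⁻¹ ^ i))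
          (MvPowerSeries.coeff n (∑ u, l u • (f u * G ^ j u)))) ∧
        ∀ n, ‖MvPowerSeries.coeff n (∑ u, l u • (f u * G ^ j u))‖ ≤ C ^ D) →
    (∀ (ρ : ℝ) (_ : 0 < ρ) (_ : ρ < 1) (μ t c₀ : ℕ) (_ : 1 ≤ μ) (_ : 1 ≤ t) (_ : 1 ≤ c₀),
      ∃ A R : ℝ, 1 ≤ A ∧ 1 < R ∧
        ∀ (D n₀ : ℕ) (x C' : ℝ), 1 ≤ D → 0 ≤ C' → x ≤ C' →
          (∀ M : ℕ, ((12 + (((c₀ * D : ℕ) : ℤ) + (M : ℤ) * (t : ℤ))) * (μ : ℤ)).toNat / 12 ≤ n₀ →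
            x ≤ C' * ρ ^ (M + 1)) →
          x ≤ C' * A ^ D * R⁻¹ ^ n₀) →
    (∀ (k : ℤ) (u : ℕ) (_ : u = k.natAbs + 1) (J : ℕ → Finset ℕ)
      (_ : ∀ b : ℕ, J b = if Even b then
        (Finset.range (b / 12 + 1)).filter (fun i ↦ b - 12 * i ≠ 2) else ∅)
      (card : ℕ → ℕ)
      (_ : ∀ D, card D = ∑ j ∈ Finset.range (D + 1), (J (((12 * u * D : ℕ) : ℤ) - j * k).toNat).card),
      (∀ D, 1 ≤ D → 1 ≤ card D) ∧ (∀ D, 1 ≤ D → (card D : ℝ) ≤ (24 * u : ℝ) ^ D) ∧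
        (∀ m : ℕ, ∃ D, 1 ≤ D ∧ 2 * (m * D) + 1 ≤ card D)) →
    ∀ (p : ℕ) [Fact p.Prime] (hp : 5 ≤ p) (N : ℕ) [NeZero N], ¬ p ∣ N →
      ∀ (k : ℤ) (ι : PadicAlgCl p ≃+* ℂ) (E : Type) [Field E] [NumberField E] (σ₀ : E →+* ℂ)
        (a : ℕ → E), (∀ n, IsIntegral ℤ (a n)) →
      (∀ (σ : E →+* ℂ) (t : ℝ), 0 < t → t < 1 → ∃ C : ℝ, ∀ n, ‖σ (a n)‖ * t ^ n ≤ C) →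
      (∃ (r C : ℝ) (c : ℕ → PowerSeries ℂ), 0 < r ∧
        (∀ i : ℕ, ∃ F : ModularForm (CongruenceSubgroup.Gamma1 N) (k + i * (p - 1 : ℕ)),
          c i = UpperHalfPlane.qExpansion 1 ⇑F) ∧
        (∀ i n : ℕ, ‖ι.symm (PowerSeries.coeff n (c i))‖ ≤ C * (p : ℝ) ^ (-(r * i))) ∧
        ∀ n : ℕ, HasSum (fun i : ℕ ↦ ι.symm (PowerSeries.coeff n (c i *
          ((UpperHalfPlane.qExpansion 1 ⇑(ModularForm.E (show 3 ≤ p - 1 by omega)))⁻¹) ^ i)))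
          (ι.symm (σ₀ (a n)))) →
      ∃ (D : ℕ) (b : ℕ → ℤ) (F : (j : ℕ) → ModularForm 𝒮ℒ (b j)),
        (∃ j ≤ D, F j ≠ 0) ∧ (∀ j, b j + j * k = b 0) ∧
        ∑ j ∈ Finset.range (D + 1),
          UpperHalfPlane.qExpansion 1 ⇑(F j) * (PowerSeries.mk fun n ↦ σ₀ (a n)) ^ j = 0 := by
  intro hR1 hR3 hR4 hR5 hR6 p _ hp N _ hpN k ι E _ _ σ₀ a hint harch hkatz
  obtain ⟨r, C, c, hr, hc, hbound, hsum⟩ := hkatz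
  classical
  /- ### 1. Constants -/
  obtain ⟨u, hu_def⟩ : ∃ u : ℕ, u = k.natAbs + 1 := ⟨_, rfl⟩
  obtain ⟨μ, hμ_def⟩ : ∃ μ : ℕ, μ = (CongruenceSubgroup.Gamma1 N).index := ⟨_, rfl⟩
  have hμ1 : 1 ≤ μ := by
    rw [hμ_def]; exact Nat.one_le_iff_ne_zero.mpr Subgroup.FiniteIndex.index_ne_zero
  have hp1 : (1 : ℝ) < p := by exact_mod_cast (Fact.out : p.Prime).one_lt
  have hρ0 : 0 < (p : ℝ) ^ (-r) := Real.rpow_pos_of_pos (by positivity) _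
  have hρ1 : (p : ℝ) ^ (-r) < 1 := Real.rpow_lt_one_of_one_lt_of_neg hp1 (by linarith)
  obtain ⟨A₅, R, hA₅, hR, hconv⟩ :=
    hR5 ((p : ℝ) ^ (-r)) hρ0 hρ1 μ (p - 1) (12 * u) hμ1 (by omega) (by omega)
  have hR0 : 0 < R := zero_lt_one.trans hR
  have hC'1 : (1 : ℝ) ≤ max 1 C := le_max_left _ _
  have hA'1 : (1 : ℝ) ≤ max 1 C * A₅ := one_le_mul_of_one_le_of_one_le hC'1 hA₅
  have hdE : 1 ≤ Module.finrank ℚ E := Module.finrank_pos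
  obtain ⟨η, hη_def⟩ : ∃ η : ℝ, η = Real.log R / (4 * (Module.finrank ℚ E)) := ⟨_, rfl⟩
  have hlogR : 0 < Real.log R := Real.log_pos hR
  have hη0 : 0 < η := by rw [hη_def]; positivity
  have hexpR : Real.exp (2 * η * (Module.finrank ℚ E)) < R := by
    have h2 : 2 * η * (Module.finrank ℚ E) = Real.log R / 2 := by
      rw [hη_def]; field_simp; ring
    rw [h2]
    calc Real.exp (Real.log R / 2) < Real.exp (Real.log R) := Real.exp_lt_exp.mpr (by linarith)
      _ = R := Real.exp_log hR0
  obtain ⟨t₀, ht₀_def⟩ : ∃ t₀ : ℝ, t₀ = Real.exp (-η) := ⟨_, rfl⟩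
  have ht₀0 : 0 < t₀ := by rw [ht₀_def]; exact Real.exp_pos _
  have ht₀1 : t₀ < 1 := by rw [ht₀_def, Real.exp_lt_one_iff]; linarith
  /- ### 2. Archimedean sizes at `t₀` -/
  obtain ⟨B₀, hB₀_def⟩ : ∃ B₀ : ℝ, B₀ = max 1 (max
      (∑' n : ℕ, ‖PowerSeries.coeff n (UpperHalfPlane.qExpansion 1 ⇑ModularForm.E₄)‖ * t₀ ^ n) (max
      (∑' n : ℕ, ‖PowerSeries.coeff n (UpperHalfPlane.qExpansion 1 ⇑ModularForm.E₆)‖ * t₀ ^ n)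
      (∑' n : ℕ, ‖PowerSeries.coeff n (UpperHalfPlane.qExpansion 1 ⇑CuspForm.discriminant)‖ * t₀ ^ n))) :=
    ⟨_, rfl⟩
  have hB₀1 : 1 ≤ B₀ := by rw [hB₀_def]; exact le_max_left _ _
  have hW₄B : ∑' n : ℕ, ‖PowerSeries.coeff n (UpperHalfPlane.qExpansion 1 ⇑ModularForm.E₄)‖ * t₀ ^ n ≤ B₀ := by
    rw [hB₀_def]; exact (le_max_left _ _).trans (le_max_right _ _)
  have hW₆B : ∑' n : ℕ, ‖PowerSeries.coeff n (UpperHalfPlane.qExpansion 1 ⇑ModularForm.E₆)‖ * t₀ ^ n ≤ B₀ := by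
    rw [hB₀_def]; exact ((le_max_left _ _).trans (le_max_right _ _)).trans (le_max_right _ _)
  have hWΔB : ∑' n : ℕ, ‖PowerSeries.coeff n (UpperHalfPlane.qExpansion 1 ⇑CuspForm.discriminant)‖ * t₀ ^ n ≤
      B₀ := by
    rw [hB₀_def]; exact ((le_max_right _ _).trans (le_max_right _ _)).trans (le_max_right _ _)
  have hSg : ∀ σ : E →+* ℂ, Summable fun n : ℕ ↦ ‖σ (a n)‖ * t₀ ^ n :=
    fun σ ↦ algMain_summable_of_radius (fun n ↦ σ (a n)) (harch σ) t₀ ht₀0.le ht₀1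
  obtain ⟨Bg, hBg_def⟩ : ∃ Bg : ℝ, Bg = 1 + ∑ σ : E →+* ℂ, ∑' n : ℕ, ‖σ (a n)‖ * t₀ ^ n := ⟨_, rfl⟩
  have hnn : ∀ τ : E →+* ℂ, 0 ≤ ∑' n : ℕ, ‖τ (a n)‖ * t₀ ^ n :=
    fun τ ↦ tsum_nonneg fun n ↦ mul_nonneg (norm_nonneg _) (pow_nonneg ht₀0.le _)
  have hWgB : ∀ σ : E →+* ℂ, ∑' n : ℕ, ‖σ (a n)‖ * t₀ ^ n ≤ Bg := by
    intro σ
    rw [hBg_def]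
    have := Finset.single_le_sum (fun τ _ ↦ hnn τ) (Finset.mem_univ σ)
    linarith
  have hBg1 : 1 ≤ Bg := by
    rw [hBg_def]
    have := Finset.sum_nonneg fun τ (_ : τ ∈ (Finset.univ : Finset (E →+* ℂ))) ↦ hnn τ
    linarith
  have hB1 : (1 : ℝ) ≤ B₀ ^ (13 * u) * Bg := one_le_mul_of_one_le_of_one_le (one_le_pow₀ hB₀1) hBg1
  /- ### 3. The unknowns: weights, index sets, the basis of R3, thresholds -/
  obtain ⟨J, hJ_def⟩ : ∃ J : ℕ → Finset ℕ, ∀ b, J b = if Even b then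
      (Finset.range (b / 12 + 1)).filter (fun i ↦ b - 12 * i ≠ 2) else ∅ := ⟨_, fun b ↦ rfl⟩
  obtain ⟨bw, hbw_def⟩ : ∃ bw : ℕ → ℕ → ℕ, ∀ D jj, bw D jj = (((12 * u * D : ℕ) : ℤ) - jj * k).toNat :=
    ⟨_, fun D jj ↦ rfl⟩
  obtain ⟨hJmem, hbw_cast, hbw_le, hβpos, hcardQ, hgrow⟩ := algMain_counts k u hu_def J hJ_def bw hbw_def
    (hR6 k u hu_def J hJ_def _ (fun D ↦ rfl)) (fun D ↦ ∑ jj ∈ Finset.range D, (J (bw D jj)).card)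
    (fun D ↦ rfl)
  have hbasis : ∀ b i, i ∈ J b → ∃ (α β : ℕ) (F : ModularForm 𝒮ℒ (b : ℤ)) (P : PowerSeries ℤ),
      4 * α + 6 * β + 12 * i = b ∧
      UpperHalfPlane.qExpansion 1 ⇑F =
        UpperHalfPlane.qExpansion 1 ⇑ModularForm.E₄ ^ α * UpperHalfPlane.qExpansion 1 ⇑ModularForm.E₆ ^ β *
          UpperHalfPlane.qExpansion 1 ⇑CuspForm.discriminant ^ i ∧
      UpperHalfPlane.qExpansion 1 ⇑F = P.map (Int.castRingHom ℂ) ∧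
      (∀ n < i, PowerSeries.coeff n P = 0) ∧ PowerSeries.coeff i P = 1 :=
    fun b i hi ↦ hR3 b i (hJmem b i hi).1 (hJmem b i hi).2.1 (hJmem b i hi).2.2
  choose αf βf Ff Pf hαβ hFprod hFP hPlt hPi using hbasis
  let β : ℕ → Type := fun D ↦ (jj : Fin D) × ↥(J (bw D jj))
  have hβcard : ∀ D, Fintype.card (β D) = ∑ jj ∈ Finset.range D, (J (bw D jj)).card := by
    intro D
    change Fintype.card ((jj : Fin D) × ↥(J (bw D jj))) = _
    rw [Fintype.card_sigma]
    simp_rw [Fintype.card_coe]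
    exact Fin.sum_univ_eq_sum_range (fun jj ↦ (J (bw D jj)).card) D
  obtain ⟨N₀, hN₀_def⟩ : ∃ N₀ : ℕ → ℕ, ∀ D, N₀ D = (Fintype.card (β D) - 1) / 2 := ⟨_, fun D ↦ rfl⟩
  have hfin : ∀ D, {ν : ℕ | id ν < N₀ D}.Finite := fun D ↦ Set.finite_lt_nat (N₀ D)
  have hncard : ∀ D, {ν : ℕ | id ν < N₀ D}.ncard = N₀ D := by
    intro D
    have : {ν : ℕ | id ν < N₀ D} = ↑(Finset.range (N₀ D)) := by ext ν; simp
    rw [this, Set.ncard_coe_finset, Finset.card_range]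
  have hcount : ∀ D, 1 ≤ D → 2 * {ν : ℕ | id ν < N₀ D}.ncard < Fintype.card (β D) := by
    intro D hD
    rw [hncard, hN₀_def]
    have := hβpos D hD
    rw [← hβcard] at this
    omega
  have hgrowth' : ∀ m : ℕ, ∃ D : ℕ, 1 ≤ D ∧ m * D ≤ N₀ D := by
    intro m
    obtain ⟨D, hD, hmD⟩ := hgrow m
    exact ⟨D, hD, by rw [hN₀_def, hβcard]; exact hmD⟩
  have hQ : ∀ D, 1 ≤ D → (Fintype.card (β D) : ℝ) ≤ (24 * u : ℝ) ^ D := by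
    intro D hD
    rw [hβcard]
    exact hcardQ D hD
  /- ### 4. The coefficients `c_D(u, ν) = coeff_ν (f_u · g^{j_u}) ∈ 𝓞_E` -/
  have ha' : ∀ n, ∃ y : 𝓞 E, algebraMap (𝓞 E) E y = a n := fun n ↦
    (IsIntegralClosure.isIntegral_iff (A := 𝓞 E)).mp (hint n)
  choose a' ha' using ha'
  let FO : (D : ℕ) → β D → PowerSeries (𝓞 E) := fun D uu ↦
    PowerSeries.map (Int.castRingHom (𝓞 E)) (Pf (bw D uu.1) uu.2.1 uu.2.2) * (PowerSeries.mk a') ^ (uu.1 : ℕ)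
  let cc : (D : ℕ) → β D → ℕ → E := fun D uu ν ↦ algebraMap (𝓞 E) E (PowerSeries.coeff ν (FO D uu))
  have hint' : ∀ D uu ν, IsIntegral ℤ (cc D uu ν) := fun D uu ν ↦
    NumberField.RingOfIntegers.isIntegral_coe _
  have hFOmap : ∀ {S : Type} [CommRing S] (φ : 𝓞 E →+* S) (D : ℕ) (uu : β D),
      PowerSeries.map φ (FO D uu) =
        PowerSeries.map (Int.castRingHom S) (Pf (bw D uu.1) uu.2.1 uu.2.2) *
          (PowerSeries.mk fun n ↦ φ (a' n)) ^ (uu.1 : ℕ) := by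
    intro S _ φ D uu
    change PowerSeries.map φ (PowerSeries.map (Int.castRingHom (𝓞 E)) _ * (PowerSeries.mk a') ^ (uu.1 : ℕ)) = _
    have h1 : ∀ P : PowerSeries ℤ, PowerSeries.map φ (PowerSeries.map (Int.castRingHom (𝓞 E)) P) =
        PowerSeries.map (Int.castRingHom S) P := fun P ↦ by
      ext n
      rw [PowerSeries.coeff_map, PowerSeries.coeff_map, PowerSeries.coeff_map, eq_intCast, eq_intCast,
        map_intCast]
    have h2 : PowerSeries.map φ (PowerSeries.mk a') = PowerSeries.mk fun n ↦ φ (a' n) := by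
      ext n
      rw [PowerSeries.coeff_map, PowerSeries.coeff_mk, PowerSeries.coeff_mk]
    rw [map_mul, map_pow, h1, h2]
  have hlin : ∀ (D : ℕ) (P : β D → 𝓞 E) (ν : ℕ),
      ∑ uu, (P uu : E) * cc D uu ν =
        algebraMap (𝓞 E) E (PowerSeries.coeff ν (∑ uu, PowerSeries.C (P uu) * FO D uu)) := by
    intro D P ν
    rw [map_sum, map_sum]
    refine Finset.sum_congr rfl fun uu _ ↦ ?_
    rw [PowerSeries.coeff_C_mul, map_mul]
  have hlin_map : ∀ {S : Type} [CommRing S] (φ : 𝓞 E →+* S) (D : ℕ) (P : β D → 𝓞 E) (ν : ℕ),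
      φ (PowerSeries.coeff ν (∑ uu, PowerSeries.C (P uu) * FO D uu)) =
        PowerSeries.coeff ν (∑ uu, φ (P uu) •
          (PowerSeries.map (Int.castRingHom S) (Pf (bw D uu.1) uu.2.1 uu.2.2) *
            (PowerSeries.mk fun n ↦ φ (a' n)) ^ (uu.1 : ℕ))) := by
    intro S _ φ D P ν
    rw [← PowerSeries.coeff_map, map_sum]
    congr 1
    refine Finset.sum_congr rfl fun uu _ ↦ ?_
    rw [map_mul, PowerSeries.map_C, hFOmap, PowerSeries.smul_eq_C_mul]
  /- ### 5. The archimedean bounds (Part I) -/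
  have harch' : ∀ (D : ℕ) (uu : β D) (ν : ℕ) (σ : E →+* ℂ),
      ‖σ (cc D uu ν)‖ ≤ (B₀ ^ (13 * u) * Bg) ^ D * Real.exp (η * (id ν : ℕ)) := by
    intro D uu ν σ
    have hjjD : (uu.1 : ℕ) ≤ D := (Fin.is_lt uu.1).le
    have hi : (uu.2 : ℕ) ∈ J (bw D uu.1) := uu.2.2
    have hσcc : σ (cc D uu ν) = PowerSeries.coeff ν
        (UpperHalfPlane.qExpansion 1 ⇑ModularForm.E₄ ^ αf _ uu.2 hi *
          UpperHalfPlane.qExpansion 1 ⇑ModularForm.E₆ ^ βf _ uu.2 hi *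
          UpperHalfPlane.qExpansion 1 ⇑CuspForm.discriminant ^ (uu.2 : ℕ) *
          (PowerSeries.mk fun n ↦ σ (a n)) ^ (uu.1 : ℕ)) := by
      have hgσ : (PowerSeries.mk fun n ↦ (σ.comp (algebraMap (𝓞 E) E)) (a' n)) =
          PowerSeries.mk fun n ↦ σ (a n) := by
        ext n
        rw [PowerSeries.coeff_mk, PowerSeries.coeff_mk, RingHom.comp_apply, ha']
      have : σ (cc D uu ν) = PowerSeries.coeff ν (PowerSeries.map (σ.comp (algebraMap (𝓞 E) E)) (FO D uu)) := by
        rw [PowerSeries.coeff_map]; rfl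
      rw [this, hFOmap, hgσ, ← hFP _ uu.2 hi, hFprod _ uu.2 hi]
    have hαβi : αf _ uu.2 hi + βf _ uu.2 hi + (uu.2 : ℕ) ≤ 13 * u * D := by
      have h1 := hαβ _ uu.2 hi
      have h2 := hbw_le D uu.1 hjjD
      omega
    change ‖σ (cc D uu ν)‖ ≤ (B₀ ^ (13 * u) * Bg) ^ D * Real.exp (η * (ν : ℕ))
    rw [hσcc, mul_pow, ← pow_mul]
    exact stub_archBound hR1 t₀ η ht₀0 ht₀1 ht₀_def B₀ Bg hB₀1 hBg1 hW₄B hW₆B hWΔB (fun n ↦ σ (a n))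
      (hSg σ) (hWgB σ) _ _ _ _ (13 * u * D) D hαβi hjjD ν
  /- ### 6. The gain (Part II) -/
  obtain ⟨v, hv_def⟩ : ∃ v : E →+* PadicAlgCl p, v = ι.symm.toRingHom.comp σ₀ := ⟨_, rfl⟩
  have hgain' : ∀ (D : ℕ) (P : β D → 𝓞 E) (n : ℕ),
      (∀ ν, id ν < n → ∑ uu, (P uu : E) * cc D uu ν = 0) →
      ∀ ν, ‖v (∑ uu, (P uu : E) * cc D uu ν)‖ ≤ (max 1 C * A₅) ^ D * R⁻¹ ^ n := by
    intro D P n hvan ν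
    rcases Nat.eq_zero_or_pos D with hD0 | hDpos
    · subst hD0
      haveI : IsEmpty (β 0) := by
        change IsEmpty ((jj : Fin 0) × ↥(J (bw 0 jj))); infer_instance
      rw [Fintype.sum_empty, map_zero, norm_zero]
      exact mul_nonneg (pow_nonneg (zero_le_one.trans hA'1) _) (pow_nonneg (inv_nonneg.mpr hR0.le) _)
    obtain ⟨FPK, hFPK_def⟩ : ∃ FPK : PowerSeries (PadicAlgCl p),
        FPK = ∑ uu : β D, (ι.symm (σ₀ ((P uu : 𝓞 E) : E))) •
          ((Pf (bw D uu.1) uu.2.1 uu.2.2).map (Int.castRingHom (PadicAlgCl p)) *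
            (PowerSeries.mk fun n ↦ ι.symm (σ₀ (a n))) ^ (uu.1 : ℕ)) := ⟨_, rfl⟩
    have hvS : ∀ ν' : ℕ, v (∑ uu, (P uu : E) * cc D uu ν') = PowerSeries.coeff (R := PadicAlgCl p) ν' FPK := by
      intro ν'
      rw [hlin, show v (algebraMap (𝓞 E) E _) = (v.comp (algebraMap (𝓞 E) E)) _ from rfl,
        hlin_map (v.comp (algebraMap (𝓞 E) E)) D P ν', hFPK_def]
      congr 1
      refine Finset.sum_congr rfl fun uu _ ↦ ?_
      have hg : (PowerSeries.mk fun n ↦ (v.comp (algebraMap (𝓞 E) E)) (a' n)) =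
          PowerSeries.mk fun n ↦ ι.symm (σ₀ (a n)) := by
        ext m
        rw [PowerSeries.coeff_mk, PowerSeries.coeff_mk, RingHom.comp_apply, ha', hv_def]
        rfl
      rw [hg, hv_def]
      rfl
    have hfU : ∀ uu : β D, ∃ F : ModularForm 𝒮ℒ ((((12 * u * D : ℕ) : ℤ)) - ((uu.1 : ℕ) : ℤ) * k),
        UpperHalfPlane.qExpansion 1 ⇑F = (Pf (bw D uu.1) uu.2.1 uu.2.2).map (Int.castRingHom ℂ) :=
      fun uu ↦ ⟨ModularForm.mcast (hbw_cast D uu.1 (Fin.is_lt uu.1).le) (Ff (bw D uu.1) uu.2.1 uu.2.2),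
        by rw [ModularForm.qExpansion_mcast, hFP]⟩
    have hvan' : ∀ m < n, PowerSeries.coeff (R := PadicAlgCl p) m FPK = 0 := fun m hm ↦ by
      rw [← hvS, hvan m hm, map_zero]
    rw [hvS]
    refine stub_gainBound p hp N hpN k ι E σ₀ a @hR4 μ hμ_def u r C c hr hc hbound hsum A₅ R ?_ D hDpos
      (U := β D) (fun uu : β D ↦ (uu.1 : ℕ)) ?_ (fun uu : β D ↦ Pf (bw D uu.1) uu.2.1 uu.2.2) ?_
      P FPK ?_ n ?_ ν
    · exact hconv
    · exact fun uu ↦ (Fin.is_lt uu.1).le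
    · exact hfU
    · exact hFPK_def
    · exact hvan'
  /- ### 7. Siegel + Liouville (stub 16), and the conclusion (Part III) -/
  obtain ⟨D, P, hP0, hrel⟩ := stub_auxLinearForms E p v ℕ id β N₀ hfin hcount hgrowth' (24 * u) hQ cc
    hint' (B₀ ^ (13 * u) * Bg) η hB1 hη0.le harch' (max 1 C * A₅) R hA'1 hexpR hgain'
  have hFPO : (∑ uu, PowerSeries.C (P uu) * FO D uu) = 0 := by
    refine PowerSeries.ext fun ν ↦ ?_
    rw [map_zero]
    have h := hrel ν
    rw [hlin] at h
    exact NumberField.RingOfIntegers.coe_injective (h.trans (map_zero _).symm)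
  have hrelC : ∑ uu : β D, σ₀ ((P uu : 𝓞 E) : E) •
      ((Pf (bw D uu.1) uu.2.1 uu.2.2).map (Int.castRingHom ℂ) *
        (PowerSeries.mk fun n ↦ σ₀ (a n)) ^ (uu.1 : ℕ)) = 0 := by
    have h := congrArg (PowerSeries.map (σ₀.comp (algebraMap (𝓞 E) E))) hFPO
    rw [map_zero, map_sum] at h
    rw [← h]
    refine Finset.sum_congr rfl fun uu _ ↦ ?_
    have hg : (PowerSeries.mk fun n ↦ (σ₀.comp (algebraMap (𝓞 E) E)) (a' n)) =
        PowerSeries.mk fun n ↦ σ₀ (a n) := by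
      ext m
      rw [PowerSeries.coeff_mk, PowerSeries.coeff_mk, RingHom.comp_apply, ha']
    rw [map_mul, PowerSeries.map_C, hFOmap, hg, PowerSeries.smul_eq_C_mul]
    rfl
  exact stub_conclude k u D E σ₀ a J (bw D) (fun jj h ↦ hbw_cast D jj h) Ff Pf hFP hPlt hPi P hP0 hrelC

end Summit.Langlands.Langlands.Theorems.HilbertIntegralOverconvergentIsCongruence

end
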